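import Summits.RiemannHypothesis.RiemannHypothesis.Theorems.S2FormatCE0
import HarnessLib

/-!
# Format C at `S = {∞, 2}` — (E0) soundness, part 1: generic lemmas and what `checkA` gives

File 3/4 of the (E0) base (seat cc-s2-4, `HOME/cc-s2-4/CC4-LEAN.md` §9.2).  Partial sums of boxed terms (`mem_psum`),
geometric tail control (`tail_bound`: `|g(j+K)| ≤ Cρ^j ⇒ Summable g ∧ |Σ_{j} g(j+K)| ≤ C/(1−ρ)`), the scaled tail ceiling
(`mul_le_tailHi`, `mem_tailBox`, `mem_tailBoxSym`), the identities `e_{j+K} = e_K r^j`, `l_k² = (4k+1)²/4`, and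
`E0.afacts_of_checkA`: the sixteen facts (`π`, `log 2`, `log π`, `√2 = e^{(log 2)/2}`, `s²`, `r`, `e_k`, `ω_n`, `E = Σe_k`,
`E₂ = Σ e_k l_k²` with the ratio majorant `ρ = r(4K+5)²/(4K+1)²`) read off `checkA = true`.
-/

set_option linter.dupNamespace false
set_option autoImplicit false

noncomputable section

open Complex Set MeasureTheory Filter Finset
open scoped Real Topology ComplexConjugate BigOperators

namespace Summit.RiemannHypothesis.RiemannHypothesis.Theorems.S2FormatC

open Literature.Analysis.SpecialFunctions

section E0
open Literature.Analysis.ValidatedNumerics.NumericsMP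

namespace E0
/-! ### Soundness, part 1: generic lemmas (partial sums, geometric tails, tail boxes) -/

section Sound
open Real

/-- Partial sums of boxed terms. -/
theorem mem_psum {S : ℕ} {f : ℕ → Option MI} {g : ℕ → ℝ} :
    ∀ (K : ℕ) {A : MI}, (∀ k < K, ∀ I, f k = some I → MI.mem S (g k) I) → psum f K = some A →
      MI.mem S (∑ k ∈ Finset.range K, g k) A
  | 0, A, _, h => by
      simp only [psum, Option.some.injEq] at h
      subst h
      simp [MI.mem]
  | K + 1, A, hf, h => by
      simp only [psum] at h
      split at h
      · rename_i A' B hA' hB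
        simp only [Option.some.injEq] at h
        subst h
        rw [Finset.sum_range_succ]
        exact MI.mem_add (mem_psum K (fun k hk ↦ hf k (by omega)) hA') (hf K (by omega) B hB)
      · simp at h

/-- Geometric domination of a tail: summability and the tail bound `C/(1 − ρ)`. -/
theorem tail_bound {g : ℕ → ℝ} {K : ℕ} {C ρ : ℝ} (hρ0 : 0 ≤ ρ) (hρ1 : ρ < 1)
    (hdom : ∀ j, |g (j + K)| ≤ C * ρ ^ j) :
    Summable g ∧ |∑' j, g (j + K)| ≤ C / (1 - ρ) := by
  have hgeo : HasSum (fun j ↦ C * ρ ^ j) (C / (1 - ρ)) := by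
    have := (hasSum_geometric_of_lt_one hρ0 hρ1).mul_left C
    simpa [div_eq_mul_inv] using this
  have hdom' : ∀ j, ‖g (j + K)‖ ≤ C * ρ ^ j := fun j ↦ by simpa [Real.norm_eq_abs] using hdom j
  have htail : Summable (fun j ↦ g (j + K)) := Summable.of_norm_bounded hgeo.summable hdom'
  refine ⟨(summable_nat_add_iff K).1 htail, ?_⟩
  have := tsum_of_norm_bounded hgeo hdom'
  simpa [Real.norm_eq_abs] using this

/-- From a box for `Σ_{k<K}` and a box for the tail to a box for the series. -/
theorem mem_addTail {S : ℕ} {g : ℕ → ℝ} {K : ℕ} {o : Option MI} {Tl Y : MI}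
    (ho : ∀ A, o = some A → MI.mem S (∑ k ∈ Finset.range K, g k) A) (hsum : Summable g)
    (htail : MI.mem S (∑' j, g (j + K)) Tl) (h : addTail o Tl = some Y) : MI.mem S (∑' k, g k) Y := by
  cases o with
  | none => simp [addTail] at h
  | some A =>
    simp only [addTail, Option.some.injEq] at h
    subst h
    rw [← hsum.sum_add_tsum_nat_add K]
    exact MI.mem_add (ho A rfl) htail

/-- The scaled tail bound: `t ≤ a(p/q)/(1−r)`, `a·S ≤ A.hi`, `r·S ≤ R.hi < S` ⇒ `t·S ≤ tailHi`. -/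
theorem mul_le_tailHi {S : ℕ} (hS : 0 < S) {a r t : ℝ} {A R : MI} (ha : MI.mem S a A) (hr : MI.mem S r R)
    (hRS : R.hi < S) {p q : ℕ} (hq : 0 < q) (ht : t ≤ a * (p / q) / (1 - r)) :
    t * S ≤ (tailHi S A R p q : ℝ) := by
  have hSr : (0 : ℝ) < S := by exact_mod_cast hS
  have hD : (0 : ℝ) < (S : ℝ) - R.hi := by
    have : (R.hi : ℝ) < ((S : ℤ) : ℝ) := by exact_mod_cast hRS
    push_cast at this; linarith
  have hr' : r ≤ (R.hi : ℝ) / S := by rw [le_div_iff₀ hSr]; exact hr.2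
  have h1r : ((S : ℝ) - R.hi) / S ≤ 1 - r := by
    rw [div_le_iff₀ hSr]
    have h2 := hr.2
    nlinarith [h2]
  have hApos : (0 : ℝ) ≤ ((max A.hi 0 : ℤ) : ℝ) := by exact_mod_cast le_max_right _ _
  have ha' : a ≤ ((max A.hi 0 : ℤ) : ℝ) / S := by
    rw [le_div_iff₀ hSr]
    exact ha.2.trans (by exact_mod_cast le_max_left _ _)
  have hpq : (0 : ℝ) ≤ (p : ℝ) / q := by positivity
  have hq' : (0 : ℝ) < q := by exact_mod_cast hq
  -- t ≤ (max A.hi 0 / S) (p/q) / ((S − R.hi)/S) = max A.hi 0 · p / (q (S − R.hi))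
  have h1 : t ≤ ((max A.hi 0 : ℤ) : ℝ) / S * (p / q) / (((S : ℝ) - R.hi) / S) := by
    refine ht.trans ?_
    have hnum : a * (p / q) ≤ ((max A.hi 0 : ℤ) : ℝ) / S * (p / q) := mul_le_mul_of_nonneg_right ha' hpq
    have hnum0 : 0 ≤ ((max A.hi 0 : ℤ) : ℝ) / S * (p / q) := by positivity
    have hden : 0 < ((S : ℝ) - R.hi) / S := by positivity
    calc a * (p / q) / (1 - r) ≤ ((max A.hi 0 : ℤ) : ℝ) / S * (p / q) / (1 - r) :=
          div_le_div_of_nonneg_right hnum (hden.le.trans h1r)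
      _ ≤ _ := div_le_div_of_nonneg_left hnum0 hden h1r
  have h2 : ((max A.hi 0 : ℤ) : ℝ) / S * (p / q) / (((S : ℝ) - R.hi) / S) * S
      = (((max A.hi 0 * p * S : ℤ) : ℝ)) / ((((S : ℤ) - R.hi) * q : ℤ) : ℝ) := by
    push_cast
    field_simp
  have hpos : (0 : ℤ) < ((S : ℤ) - R.hi) * q := by
    have : (0 : ℤ) < (S : ℤ) - R.hi := by omega
    exact mul_pos this (by exact_mod_cast hq)
  calc t * S ≤ ((max A.hi 0 : ℤ) : ℝ) / S * (p / q) / (((S : ℝ) - R.hi) / S) * S :=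
        mul_le_mul_of_nonneg_right h1 hSr.le
    _ = (((max A.hi 0 * p * S : ℤ) : ℝ)) / ((((S : ℤ) - R.hi) * q : ℤ) : ℝ) := h2
    _ ≤ _ := by
        unfold tailHi
        exact Literature.Analysis.ValidatedNumerics.Numerics.div_le_cdiv hpos

/-- One-sided tail box. -/
theorem mem_tailBox {S : ℕ} (hS : 0 < S) {a r t : ℝ} {A R : MI} (ha : MI.mem S a A) (hr : MI.mem S r R)
    (hRS : R.hi < S) {p q : ℕ} (hq : 0 < q) (ht0 : 0 ≤ t) (ht : t ≤ a * (p / q) / (1 - r)) :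
    MI.mem S t (tailBox S A R p q) := by
  refine ⟨?_, mul_le_tailHi hS ha hr hRS hq ht⟩
  simp only [tailBox, Int.cast_zero]
  have : (0 : ℝ) ≤ S := by positivity
  positivity

/-- Symmetric tail box. -/
theorem mem_tailBoxSym {S : ℕ} (hS : 0 < S) {a r t : ℝ} {A R : MI} (ha : MI.mem S a A) (hr : MI.mem S r R)
    (hRS : R.hi < S) {p q : ℕ} (hq : 0 < q) (ht : |t| ≤ a * (p / q) / (1 - r)) :
    MI.mem S t (tailBoxSym S A R p q) := by
  have hS' : (0 : ℝ) ≤ S := by positivity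
  have hup := mul_le_tailHi hS ha hr hRS hq ((le_abs_self t).trans ht)
  have hdn := mul_le_tailHi hS ha hr hRS hq ((neg_le_abs t).trans ht)
  refine ⟨?_, hup⟩
  simp only [tailBoxSym, Int.cast_neg]
  nlinarith

/-- `e_{j+K} = e_K r^j`, `r = e^{−4b}`. -/
theorem eNode_add (b : ℝ) (j K : ℕ) : eNode b (j + K) = eNode b K * Real.exp (-(4 * b)) ^ j := by
  unfold eNode digammaNode
  rw [← Real.exp_nat_mul, ← Real.exp_add]
  congr 1
  push_cast
  ring

/-- `e_k > 0`. -/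
theorem eNode_pos (b : ℝ) (k : ℕ) : 0 < eNode b k := Real.exp_pos _

/-- `l_k² = (4k+1)²/4`. -/
theorem digammaNode_sq (k : ℕ) : digammaNode k ^ 2 = (((4 * k + 1) ^ 2 : ℕ) : ℤ) / (4 : ℕ) := by
  unfold digammaNode; push_cast; ring

/-- `l_k² ∈ lSqBox`. -/
theorem mem_lSqBox (S k : ℕ) : MI.mem S (digammaNode k ^ 2) (lSqBox S k) := by
  rw [digammaNode_sq]; exact MI.mem_ofFrac S _ (by norm_num)

/-- `l_k` is increasing. -/
theorem digammaNode_mono {j k : ℕ} (h : j ≤ k) : digammaNode j ≤ digammaNode k := by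
  unfold digammaNode
  have : (j : ℝ) ≤ k := by exact_mod_cast h
  linarith

end Sound


/-! ### Soundness, part 2: what `checkA` gives -/

section SoundA
open Real

variable {P : Params} {T : EntryInputs} {X : Aux} {b : ℝ}

/-- `exp (p/q) ∈ expFrac`. -/
theorem mem_expFrac (hS : 0 < T.S) {p : ℤ} {q : ℕ} (hq : 0 < q) {Y : MI} (h : expFrac T P p q = some Y) :
    MI.mem T.S (Real.exp ((p : ℝ) / q)) Y :=
  MI.mem_exp hS h (MI.mem_ofFrac T.S p hq)

/-- `e_k = exp(−b(4k+1))`. -/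
theorem eNode_eq (hb : b = P.bnum / P.bden) (hbden : 0 < P.bden) (k : ℕ) :
    eNode b k = Real.exp (((-((P.bnum * (4 * k + 1) : ℕ) : ℤ) : ℤ) : ℝ) / (P.bden : ℕ)) := by
  unfold eNode digammaNode
  congr 1
  rw [hb]
  have : (P.bden : ℝ) ≠ 0 := by exact_mod_cast hbden.ne'
  push_cast
  field_simp
  ring

/-- `e_k ∈ eBoxOf`. -/
theorem mem_eBoxOf (hS : 0 < T.S) (hb : b = P.bnum / P.bden) (hbden : 0 < P.bden) {k : ℕ} {Y : MI}
    (h : eBoxOf T P k = some Y) : MI.mem T.S (eNode b k) Y := by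
  rw [eNode_eq hb hbden k]; exact mem_expFrac hS hbden h

/-- `r = e^{−4b} ∈ rBoxOf`. -/
theorem mem_rBoxOf (hS : 0 < T.S) (hb : b = P.bnum / P.bden) (hbden : 0 < P.bden) {Y : MI}
    (h : rBoxOf T P = some Y) : MI.mem T.S (Real.exp (-(4 * b))) Y := by
  have e : -(4 * b) = (((-((4 * P.bnum : ℕ) : ℤ)) : ℤ) : ℝ) / (P.bden : ℕ) := by
    rw [hb]; have : (P.bden : ℝ) ≠ 0 := by exact_mod_cast hbden.ne'
    push_cast; field_simp
  rw [e]; exact mem_expFrac hS hbden h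

/-- `ω_n = πn/b ∈ omBoxOf` (from `π ∈ piBox` and `b = bnum/bden`). -/
theorem mem_omBoxOf (hpi : MI.mem T.S π T.piBox) (hb : b = P.bnum / P.bden) (hbnum : 0 < P.bnum)
    (hbden : 0 < P.bden) (n : ℕ) : MI.mem T.S (omega b n) (omBoxOf T P n) := by
  have h := MI.mem_divNat (MI.mem_mulInt hpi ((n * P.bden : ℕ) : ℤ)) hbnum
  have e : π * (((n * P.bden : ℕ) : ℤ) : ℝ) / (P.bnum : ℕ) = omega b n := by
    unfold omega; rw [hb]
    have h1 : (P.bden : ℝ) ≠ 0 := by exact_mod_cast hbden.ne'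
    have h2 : (P.bnum : ℝ) ≠ 0 := by exact_mod_cast hbnum.ne'
    push_cast; field_simp
  rw [← e]; exact h

/-- `s² ∈ sSqBoxOf`. -/
theorem mem_sSqBoxOf (hS : 0 < T.S) (hb : b = P.bnum / P.bden) (hbden : 0 < P.bden) {Y : MI}
    (h : sSqBoxOf T P = some Y) : MI.mem T.S (S2FormatC.sSq b) Y := by
  unfold sSqBoxOf at h
  split at h
  · rename_i A B hA hB
    simp only [Option.some.injEq] at h
    subst h
    have h2 : 0 < 2 * P.bden := by omega
    have hA' := mem_expFrac hS h2 hA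
    have hB' := mem_expFrac hS h2 hB
    have hne : (P.bden : ℝ) ≠ 0 := by exact_mod_cast hbden.ne'
    have e1 : ((P.bnum : ℤ) : ℝ) / ((2 * P.bden : ℕ) : ℝ) = b / 2 := by rw [hb]; push_cast; field_simp
    have e2 : ((-(P.bnum : ℤ) : ℤ) : ℝ) / ((2 * P.bden : ℕ) : ℝ) = -(b / 2) := by rw [hb]; push_cast; field_simp
    rw [e1] at hA'; rw [e2] at hB'
    unfold S2FormatC.sSq
    exact MI.mem_sqr hS (MI.mem_sub hA' hB')
  · simp at h

/-- `√2 = e^{(log 2)/2}` (so `MI.exp` encloses `√2`). -/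
theorem sqrt_two_eq_exp : Real.sqrt 2 = Real.exp (Real.log 2 / (2 : ℕ)) := by
  rw [Real.sqrt_eq_rpow, Real.rpow_def_of_pos (by norm_num : (0:ℝ) < 2)]
  congr 1; push_cast; ring

/-- **`checkA` is sound.** -/
theorem afacts_of_checkA (hb : b = P.bnum / P.bden) (h : checkA P T X = true) : AFacts P T X b := by
  unfold checkA at h
  simp only [Bool.and_eq_true, decide_eq_true_eq, List.all_eq_true, List.mem_range] at h
  obtain ⟨⟨⟨⟨⟨⟨⟨⟨⟨⟨⟨⟨⟨⟨hS, hbnum⟩, hbden⟩, hpi⟩, hl2⟩, hlpi⟩, hsqrt⟩, hsSq⟩, hr⟩, hrlt⟩, hrho⟩,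
    he⟩, hom⟩, heTot⟩, heTwo⟩ := h
  have pi : MI.mem T.S π T.piBox := mem_of_optIncl hpi (fun I hI ↦ MI.mem_piMachin hS hI)
  have logTwo : MI.mem T.S (Real.log 2) T.logTwoBox := mem_of_optIncl hl2 (fun I hI ↦ MI.mem_logTwo hS hI)
  have r : MI.mem T.S (Real.exp (-(4 * b))) X.rBox := mem_of_optIncl hr (fun I hI ↦ mem_rBoxOf hS hb hbden hI)
  have e : ∀ k ≤ P.Ke, MI.mem T.S (eNode b k) (X.eBox.getD k default) := fun k hk ↦
    mem_of_optIncl (he k (by omega)) (fun I hI ↦ mem_eBoxOf hS hb hbden hI)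
  have om : ∀ n ≤ T.M₃, MI.mem T.S (omega b n) (X.omBox.getD n default) := fun n hn ↦
    mem_of_incl (mem_omBoxOf pi hb hbnum hbden n) (hom n (by omega))
  refine ⟨hS, hbnum, hbden, hb, pi, logTwo, ?_, ?_, ?_, r, hrlt, hrho, e, om, ?_, ?_⟩
  · exact mem_of_optIncl hlpi (fun I hI ↦ (MI.mem_logPos hS hI pi).2)
  · rw [sqrt_two_eq_exp]
    exact mem_of_optIncl hsqrt (fun I hI ↦ MI.mem_exp hS hI (MI.mem_divNat logTwo (by norm_num)))
  · exact mem_of_optIncl hsSq (fun I hI ↦ mem_sSqBoxOf hS hb hbden hI)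
  · -- E = Σ e_k
    refine mem_of_optIncl heTot (fun I hI ↦ ?_)
    unfold eTotBoxOf at hI
    have hr0 : 0 ≤ Real.exp (-(4 * b)) := (Real.exp_pos _).le
    have hr1 : Real.exp (-(4 * b)) < 1 := by
      have := MI.lt_of_hi_lt_lo r (MI.mem_ofInt T.S 1) (by show X.rBox.hi < (1 : ℤ) * (T.S : ℤ); simpa using hrlt)
      exact_mod_cast this
    have hdom : ∀ j, |eNode b (j + P.Ke)| ≤ eNode b P.Ke * Real.exp (-(4 * b)) ^ j := fun j ↦ by
      rw [abs_of_pos (eNode_pos b _), eNode_add]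
    obtain ⟨hsum, htail⟩ := tail_bound hr0 hr1 hdom
    refine mem_addTail (g := fun k ↦ eNode b k) (fun A hA ↦ mem_psum P.Ke (fun k hk I hI ↦ ?_) hA) hsum ?_ hI
    · simp only [termETot, Option.some.injEq] at hI; subst hI; exact e k hk.le
    · refine mem_tailBox hS (e P.Ke le_rfl) r hrlt (by norm_num) (tsum_nonneg fun j ↦ (eNode_pos b _).le) ?_
      refine (le_abs_self _).trans (htail.trans (le_of_eq ?_))
      push_cast; ring
  · -- E₂ = Σ e_k l_k²
    refine mem_of_optIncl heTwo (fun I hI ↦ ?_)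
    unfold eTwoBoxOf at hI
    set ρ : ℝ := Real.exp (-(4 * b)) * ((((4 * P.Ke + 5) ^ 2 : ℕ) : ℤ) : ℝ) / (((4 * P.Ke + 1) ^ 2 : ℕ) : ℝ)
      with hρ
    have hρmem : MI.mem T.S ρ (rhoBox P X) := by
      unfold rhoBox; exact MI.mem_divNat (MI.mem_mulInt r _) (by positivity)
    have hρ0 : 0 ≤ ρ := by positivity
    have hρ1 : ρ < 1 := by
      have := MI.lt_of_hi_lt_lo hρmem (MI.mem_ofInt T.S 1)
        (by show (rhoBox P X).hi < (1 : ℤ) * (T.S : ℤ); simpa using hrho)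
      exact_mod_cast this
    have hr0 : 0 ≤ Real.exp (-(4 * b)) := (Real.exp_pos _).le
    -- ratio step: l_{m+1}² r ≤ ρ l_m² for m ≥ K
    have hratio : ∀ m, P.Ke ≤ m →
        digammaNode (m + 1) ^ 2 * Real.exp (-(4 * b)) ≤ ρ * digammaNode m ^ 2 := by
      intro m hm
      have hK : (P.Ke : ℝ) ≤ m := by exact_mod_cast hm
      have hr0' : 0 ≤ Real.exp (-(4 * b)) := hr0
      have hpos : (0 : ℝ) < (((4 * P.Ke + 1) ^ 2 : ℕ) : ℝ) := by positivity
      -- (2m + 5/2)(4K+1) ≤ (4K+5)(2m + 1/2)  ⇔  8m + 10K + 5/2 ... reduces to K ≤ m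
      have hq : (2 * ((m : ℝ) + 1) + 1 / 2) * (4 * P.Ke + 1) ≤ (4 * P.Ke + 5) * (2 * m + 1 / 2) := by
        nlinarith
      have h0a : (0 : ℝ) ≤ 2 * ((m : ℝ) + 1) + 1 / 2 := by positivity
      have h0b : (0 : ℝ) ≤ 4 * (P.Ke : ℝ) + 1 := by positivity
      have hq2 := mul_le_mul hq hq (by positivity) (by positivity)
      have key : (2 * ((m : ℝ) + 1) + 1 / 2) ^ 2 * Real.exp (-(4 * b)) * (4 * P.Ke + 1) ^ 2
          ≤ Real.exp (-(4 * b)) * (4 * P.Ke + 5) ^ 2 * (2 * m + 1 / 2) ^ 2 := by nlinarith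
      rw [hρ]
      unfold digammaNode
      rw [show Real.exp (-(4 * b)) * ((((4 * P.Ke + 5) ^ 2 : ℕ) : ℤ) : ℝ) / (((4 * P.Ke + 1) ^ 2 : ℕ) : ℝ)
          * (2 * (m : ℝ) + 1 / 2) ^ 2 = Real.exp (-(4 * b)) * ((((4 * P.Ke + 5) ^ 2 : ℕ) : ℤ) : ℝ)
          * (2 * (m : ℝ) + 1 / 2) ^ 2 / (((4 * P.Ke + 1) ^ 2 : ℕ) : ℝ) by ring]
      rw [le_div_iff₀ hpos]
      push_cast
      linarith [key]
    have hdom : ∀ j, |eNode b (j + P.Ke) * digammaNode (j + P.Ke) ^ 2|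
        ≤ eNode b P.Ke * digammaNode P.Ke ^ 2 * ρ ^ j := by
      intro j
      rw [abs_of_nonneg (by have := eNode_pos b (j + P.Ke); positivity)]
      induction j with
      | zero => simp
      | succ j ih =>
        have e1 : eNode b (j + 1 + P.Ke) = eNode b (j + P.Ke) * Real.exp (-(4 * b)) := by
          rw [show j + 1 + P.Ke = 1 + (j + P.Ke) by ring, eNode_add]; ring
        have h1 := hratio (j + P.Ke) (by omega)
        have e2 : j + 1 + P.Ke = j + P.Ke + 1 := by ring
        rw [e1, e2]
        have he0 := (eNode_pos b (j + P.Ke)).le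
        calc eNode b (j + P.Ke) * Real.exp (-(4 * b)) * digammaNode (j + P.Ke + 1) ^ 2
            = eNode b (j + P.Ke) * (digammaNode (j + P.Ke + 1) ^ 2 * Real.exp (-(4 * b))) := by ring
          _ ≤ eNode b (j + P.Ke) * (ρ * digammaNode (j + P.Ke) ^ 2) := mul_le_mul_of_nonneg_left h1 he0
          _ = ρ * (eNode b (j + P.Ke) * digammaNode (j + P.Ke) ^ 2) := by ring
          _ ≤ ρ * (eNode b P.Ke * digammaNode P.Ke ^ 2 * ρ ^ j) := mul_le_mul_of_nonneg_left ih hρ0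
          _ = eNode b P.Ke * digammaNode P.Ke ^ 2 * ρ ^ (j + 1) := by ring
    obtain ⟨hsum, htail⟩ := tail_bound (g := fun k ↦ eNode b k * digammaNode k ^ 2) hρ0 hρ1 hdom
    refine mem_addTail (g := fun k ↦ eNode b k * digammaNode k ^ 2)
      (fun A hA ↦ mem_psum P.Ke (fun k hk I hI ↦ ?_) hA) hsum ?_ hI
    · simp only [termETwo, Option.some.injEq] at hI; subst hI
      exact MI.mem_mul hS (e k hk.le) (mem_lSqBox T.S k)
    · refine mem_tailBox hS (e P.Ke le_rfl) hρmem hrho (by norm_num)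
        (tsum_nonneg fun j ↦ by have := eNode_pos b (j + P.Ke); positivity) ?_
      refine (le_abs_self _).trans (htail.trans (le_of_eq ?_))
      rw [digammaNode_sq]; push_cast; ring

end SoundA



end E0

end E0

end Summit.RiemannHypothesis.RiemannHypothesis.Theorems.S2FormatC

end
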